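import Summits.AtomisticToContinuum.HydrodynamicLimit.Theorems.CollisionIsometryCLTDiffuseBackwardInfluenceSupersatDefs
import Summits.AtomisticToContinuum.HydrodynamicLimit.Theorems.CollisionIsometryCLTDiffuseBackwardInfluenceSupersatOcc
import Summits.AtomisticToContinuum.HydrodynamicLimit.Theorems.CollisionIsometryCLTDiffuseBackwardInfluenceSupersatPair
import Summits.AtomisticToContinuum.HydrodynamicLimit.Theorems.CollisionIsometryCLTDiffuseBackwardInfluenceSupersatSlow
import HarnessLib

/-!
# The 7/3 crossing-energy law for random sticks — assembly of `FewIdle.StickSupersat`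
(crux `DiffuseBackwardInfluence`, stmt-AtomisticToContinuum-12950, line `share-nondegeneracy-one-flight`;
registered stub `stub_stickSupersat` = sub-goal (D) of `stub_stickLD`)

`FewIdle.StickSupersat σ θ` (`…StickLD.lean`): there is `c₁ = c₁(θ) > 0` with
`∫_S μ({Cross ε_N τ z ·} ∩ S) dμ(z) ≥ c₁ ε_N² τ ρ^{4/3} μ(S)` for every `N`, `τ, ρ ∈ (0, 1]` and measurable `S` with
`μ(S) ≥ ρ` (`μ = oneStickLaw θ`, `ε_N = hsDiameter σ N ≤ σ < 1/2`). It is assembled here from the three registered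
inputs by the occupation-time trick `P(T > 0) ≥ E[T] / sup T` and one Cauchy–Schwarz:

* (A) `occ_fast_bound` (`…SupersatOcc.lean`): for relative speed `≥ w₀` the occupation time is `≤ 2ε(τ + 2√3/w₀)`;
* (B) `fixedTime_bound_reg` (`…SupersatPair.lean`): at a fixed time,
  `(μ ⊗ μ)(S × S ∩ {dist < ε}) ≥ vol(B_{ε/2}) μ(S)²`;
* (C) `slow_time_integral_bound` (`…SupersatSlow.lean`): the slow (`‖v − v'‖ < w₀`) near pairs have time-integrated
  mass `≤ τ vol(B_ε) (2πθ)^{-3/2} vol(B_{w₀})`.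

Steps: (1) `J := ∫_S∫_S occ = ∫_0^τ (μ ⊗ μ)(S × S ∩ {dist_r < ε}) dr ≥ τ vol(B_{ε/2}) μ(S)²` (Tonelli + (B));
(2) `J ≤ Tm · e + μ(S) τ vol(B_ε) c_θ vol(B_{w₀})` with `Tm = 2ε(τ + 2√3/w₀)`, `e` the crossing energy (fast pairs by
(A) and `occ = 0` off the crossing event; slow pairs by (C)); (3) with `s = μ(S)`, `t = s^{1/3}`, `w₀ = κ t`,
`16 v₁ c_θ κ³ = 1`: `Tm · e ≥ τ v₁ ε³ s²/16`; (4) `Tm · t ≤ ε(2 + 4√3/κ)` gives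
`e ≥ c₁ ε² τ s^{7/3} ≥ c₁ ε² τ ρ^{4/3} s` with `c₁ = v₁ / (16 (2 + 4√3/κ))`.
-/

namespace Summit.AtomisticToContinuum.HydrodynamicLimit.Theorems.DiffuseBackwardInfluenceShare

open scoped BigOperators Topology ENNReal Classical
open Filter Set MeasureTheory
open Literature.Analysis.FluidPDE
open Literature.MathematicalPhysics.KineticTheory (hsDiameter hsDiameter_pos hsDiameter_le)
open Summit.AtomisticToContinuum.HydrodynamicLimit.Theorems.DiffuseBackwardInfluenceNeg

noncomputable section

namespace FewIdle

namespace SupersatAssembly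

open Supersat

/-- The indicator of `{crossDist < ε}` on (pair of sticks) × time is measurable (the set is open). [folklore] -/
theorem measurable_nearIndicator (ε : ℝ) :
    Measurable ({p : ((T3 × V3) × (T3 × V3)) × ℝ | crossDist p < ε}.indicator
      (1 : (((T3 × V3) × (T3 × V3)) × ℝ) → ℝ≥0∞)) :=
  measurable_one.indicator (isOpen_lt continuous_crossDist continuous_const).measurableSet

/-- The occupation time as a time integral of the near indicator. [folklore] -/
theorem occ_eq_lintegral (ε τ : ℝ) (q : (T3 × V3) × (T3 × V3)) :
    occ ε τ q.1 q.2 = ∫⁻ r in Icc (0 : ℝ) τ, {p : ((T3 × V3) × (T3 × V3)) × ℝ | crossDist p < ε}.indicator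
      (1 : (((T3 × V3) × (T3 × V3)) × ℝ) → ℝ≥0∞) (q, r) := by
  have hmeas : MeasurableSet {r : ℝ | crossDist (q, r) < ε} :=
    (isOpen_lt (continuous_crossDist.comp (continuous_const.prodMk continuous_id))
      continuous_const).measurableSet
  have hfun : (fun r : ℝ => {p : ((T3 × V3) × (T3 × V3)) × ℝ | crossDist p < ε}.indicator
      (1 : (((T3 × V3) × (T3 × V3)) × ℝ) → ℝ≥0∞) (q, r)) = {r : ℝ | crossDist (q, r) < ε}.indicator 1 := by
    funext r
    simp only [Set.indicator_apply, mem_setOf_eq, Pi.one_apply]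
  rw [hfun, lintegral_indicator_one hmeas, Measure.restrict_apply hmeas]
  unfold occ
  congr 1
  ext r
  exact ⟨fun h => ⟨h.2, h.1⟩, fun h => ⟨h.2, h.1⟩⟩

/-- The occupation time is a measurable function of the pair of sticks. [folklore] -/
theorem measurable_occ (ε τ : ℝ) : Measurable fun q : (T3 × V3) × (T3 × V3) => occ ε τ q.1 q.2 := by
  have h : (fun q : (T3 × V3) × (T3 × V3) => occ ε τ q.1 q.2) = fun q => ∫⁻ r in Icc (0 : ℝ) τ,
      {p : ((T3 × V3) × (T3 × V3)) × ℝ | crossDist p < ε}.indicator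
        (1 : (((T3 × V3) × (T3 × V3)) × ℝ) → ℝ≥0∞) (q, r) :=
    funext (occ_eq_lintegral ε τ)
  rw [h]
  exact (measurable_nearIndicator ε).lintegral_prod_right'

/-- **Step (1)** — the crossing energy from below: `∫_S ∫_S occ ≥ τ · vol(B_{ε/2}) · μ(S)²` (Tonelli in time,
then the fixed-time pair-correlation bound `fixedTime_bound_reg`). [folklore] -/
theorem occ_energy_lower (θ : ℝ) [IsProbabilityMeasure (oneStickLaw θ)] (S : Set (T3 × V3))
    (hS : MeasurableSet S) (ε τ : ℝ) (hε : 0 < ε) (hε1 : ε < 1) :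
    ENNReal.ofReal τ * (volume (Metric.ball (0 : V3) (ε / 2)) * oneStickLaw θ S ^ 2) ≤
      ∫⁻ z in S, ∫⁻ z' in S, occ ε τ z z' ∂(oneStickLaw θ) ∂(oneStickLaw θ) := by
  set μ := oneStickLaw θ with hμ
  set F : ((T3 × V3) × (T3 × V3)) × ℝ → ℝ≥0∞ := {p : ((T3 × V3) × (T3 × V3)) × ℝ | crossDist p < ε}.indicator
    (1 : (((T3 × V3) × (T3 × V3)) × ℝ) → ℝ≥0∞) with hF
  have hFm : Measurable F := measurable_nearIndicator ε
  -- iterated integral = product integral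
  have h1 : ∫⁻ z in S, ∫⁻ z' in S, occ ε τ z z' ∂μ ∂μ = ∫⁻ q in S ×ˢ S, occ ε τ q.1 q.2 ∂(μ.prod μ) :=
    (setLIntegral_prod (fun q : (T3 × V3) × (T3 × V3) => occ ε τ q.1 q.2)
      (measurable_occ ε τ).aemeasurable).symm
  -- occupation time as a time integral, then swap
  have h2 : ∫⁻ q in S ×ˢ S, occ ε τ q.1 q.2 ∂(μ.prod μ) =
      ∫⁻ r in Icc (0 : ℝ) τ, (∫⁻ q in S ×ˢ S, F (q, r) ∂(μ.prod μ)) := by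
    have : ∫⁻ q in S ×ˢ S, occ ε τ q.1 q.2 ∂(μ.prod μ) =
        ∫⁻ q in S ×ˢ S, (∫⁻ r in Icc (0 : ℝ) τ, F (q, r)) ∂(μ.prod μ) :=
      lintegral_congr fun q => occ_eq_lintegral ε τ q
    rw [this]
    exact lintegral_lintegral_swap (hFm.comp (measurable_fst.prodMk measurable_snd)).aemeasurable
  -- the fixed-time bound
  have h3 : ∀ r : ℝ,
      volume (Metric.ball (0 : V3) (ε / 2)) * μ S ^ 2 ≤ ∫⁻ q in S ×ˢ S, F (q, r) ∂(μ.prod μ) := by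
    intro r
    have hB := fixedTime_bound_reg θ S hS r ε hε hε1
    refine hB.trans_eq ?_
    rw [← lintegral_indicator (hS.prod hS)]
    refine lintegral_congr fun q => ?_
    have : (fun q : (T3 × V3) × (T3 × V3) => F (q, r)) =
        {q : (T3 × V3) × (T3 × V3) | crossDist (q, r) < ε}.indicator 1 := by
      funext q'
      simp only [hF, Set.indicator_apply, mem_setOf_eq, Pi.one_apply]
    rw [this, Set.indicator_indicator]
    rfl
  rw [h1, h2]
  calc ENNReal.ofReal τ * (volume (Metric.ball (0 : V3) (ε / 2)) * μ S ^ 2)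
      = ∫⁻ _ in Icc (0 : ℝ) τ, volume (Metric.ball (0 : V3) (ε / 2)) * μ S ^ 2 := by
        rw [setLIntegral_const, Real.volume_Icc, sub_zero, mul_comm]
    _ ≤ ∫⁻ r in Icc (0 : ℝ) τ, (∫⁻ q in S ×ˢ S, F (q, r) ∂(μ.prod μ)) := lintegral_mono fun r => h3 r

/-- Pointwise FAST/SLOW split of the occupation time: on the fast event (`‖v − v'‖ ≥ w₀`) it is at most
`2ε(τ + 2√3/w₀)` and vanishes off the crossing event (`occ_fast_bound`, `cross_of_occ_ne_zero`); on the slow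
event it is the time integral of `slowNear`. [folklore] -/
theorem occ_le_fast_add_slow (ε τ w₀ : ℝ) (hε : 0 < ε) (hτ : 0 ≤ τ) (hw₀ : 0 < w₀) (z z' : T3 × V3) :
    occ ε τ z z' ≤
      ENNReal.ofReal (2 * ε * (τ + 2 * Real.sqrt 3 / w₀)) * {z' : T3 × V3 | Cross ε τ z z'}.indicator 1 z' +
        ∫⁻ r in Icc (0 : ℝ) τ, slowNear ε w₀ z z' r := by
  by_cases hfast : w₀ ≤ ‖z.2 - z'.2‖
  · by_cases h0 : occ ε τ z z' = 0
    · rw [h0]; exact bot_le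
    · have hc : z' ∈ {z' : T3 × V3 | Cross ε τ z z'} := cross_of_occ_ne_zero h0
      calc occ ε τ z z' ≤ ENNReal.ofReal (2 * ε * (τ + 2 * Real.sqrt 3 / w₀)) :=
            occ_fast_bound ε τ w₀ hε hτ hw₀ z z' hfast
        _ = ENNReal.ofReal (2 * ε * (τ + 2 * Real.sqrt 3 / w₀)) *
              {z' : T3 × V3 | Cross ε τ z z'}.indicator 1 z' := by
            rw [indicator_of_mem hc, Pi.one_apply, mul_one]
        _ ≤ _ := le_self_add
  · push Not at hfast
    calc occ ε τ z z'
        = ∫⁻ r in Icc (0 : ℝ) τ, {p : ((T3 × V3) × (T3 × V3)) × ℝ | crossDist p < ε}.indicator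
            (1 : (((T3 × V3) × (T3 × V3)) × ℝ) → ℝ≥0∞) ((z, z'), r) := occ_eq_lintegral ε τ (z, z')
      _ = ∫⁻ r in Icc (0 : ℝ) τ, slowNear ε w₀ z z' r := by
          refine lintegral_congr fun r => ?_
          rw [slowNear_eq_ite]
          simp only [Set.indicator_apply, mem_setOf_eq, Pi.one_apply, crossDist_eq_euclidDist_posAt, hfast,
            true_and]
      _ ≤ _ := le_add_self

/-- **Step (2)** — the crossing energy from above: integrating the fast/slow split over `S × S`, the fast part
is at most `2ε(τ + 2√3/w₀)` times the crossing energy `∫_S μ({Cross z ·} ∩ S) dμ`, the slow part at most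
`μ(S) · τ · vol(B_ε) · (2πθ)^{-3/2} · vol(B_{w₀})` (`slow_time_integral_bound`). [folklore] -/
theorem occ_energy_upper (θ : ℝ) [IsProbabilityMeasure (oneStickLaw θ)] (hθ : 0 < θ) (S : Set (T3 × V3))
    (ε τ w₀ : ℝ) (hε : 0 < ε) (hε2 : ε < 1 / 2) (hτ : 0 ≤ τ) (hw₀ : 0 < w₀) :
    ∫⁻ z in S, ∫⁻ z' in S, occ ε τ z z' ∂(oneStickLaw θ) ∂(oneStickLaw θ) ≤
      ENNReal.ofReal (2 * ε * (τ + 2 * Real.sqrt 3 / w₀)) *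
          ∫⁻ z in S, oneStickLaw θ ({z' | Cross ε τ z z'} ∩ S) ∂(oneStickLaw θ) +
        ENNReal.ofReal τ * (volume (Metric.ball (0 : V3) ε) *
          (ENNReal.ofReal ((2 * Real.pi * θ) ^ (-(Module.finrank ℝ V3 : ℝ) / 2)) *
            volume (Metric.ball (0 : V3) w₀))) * oneStickLaw θ S := by
  set μ := oneStickLaw θ with hμ
  set Tm : ℝ≥0∞ := ENNReal.ofReal (2 * ε * (τ + 2 * Real.sqrt 3 / w₀)) with hTm
  set Cs : ℝ≥0∞ := ENNReal.ofReal τ * (volume (Metric.ball (0 : V3) ε) *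
    (ENNReal.ofReal ((2 * Real.pi * θ) ^ (-(Module.finrank ℝ V3 : ℝ) / 2)) *
      volume (Metric.ball (0 : V3) w₀))) with hCs
  have hinner : ∀ z : T3 × V3, ∫⁻ z' in S, occ ε τ z z' ∂μ ≤ Tm * μ ({z' | Cross ε τ z z'} ∩ S) + Cs := by
    intro z
    have hmC : MeasurableSet {z' : T3 × V3 | Cross ε τ z z'} :=
      measurable_prodMk_left (measurableSet_setOf_cross ε τ)
    calc ∫⁻ z' in S, occ ε τ z z' ∂μ
        ≤ ∫⁻ z' in S, (Tm * {z' : T3 × V3 | Cross ε τ z z'}.indicator 1 z' +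
            ∫⁻ r in Icc (0 : ℝ) τ, slowNear ε w₀ z z' r) ∂μ :=
          lintegral_mono fun z' => occ_le_fast_add_slow ε τ w₀ hε hτ hw₀ z z'
      _ = ∫⁻ z' in S, Tm * {z' : T3 × V3 | Cross ε τ z z'}.indicator 1 z' ∂μ +
            ∫⁻ z' in S, (∫⁻ r in Icc (0 : ℝ) τ, slowNear ε w₀ z z' r) ∂μ :=
          lintegral_add_left ((measurable_one.indicator hmC).const_mul Tm) _
      _ ≤ Tm * μ ({z' | Cross ε τ z z'} ∩ S) + Cs := by
          refine add_le_add (le_of_eq ?_) ?_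
          · rw [lintegral_const_mul' _ _ ENNReal.ofReal_ne_top, lintegral_indicator_one hmC,
              Measure.restrict_apply hmC]
          · exact (setLIntegral_le_lintegral S _).trans (slow_time_integral_bound θ hθ z ε hε2 τ w₀)
  calc ∫⁻ z in S, ∫⁻ z' in S, occ ε τ z z' ∂μ ∂μ
      ≤ ∫⁻ z in S, (Tm * μ ({z' | Cross ε τ z z'} ∩ S) + Cs) ∂μ := lintegral_mono fun z => hinner z
    _ = ∫⁻ z in S, Tm * μ ({z' | Cross ε τ z z'} ∩ S) ∂μ + ∫⁻ _ in S, Cs ∂μ :=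
        lintegral_add_right _ measurable_const
    _ = Tm * ∫⁻ z in S, μ ({z' | Cross ε τ z z'} ∩ S) ∂μ + Cs * μ S := by
        rw [lintegral_const_mul' _ _ ENNReal.ofReal_ne_top, setLIntegral_const]

/-- **Steps (3)–(4)** — the real arithmetic: from `τ v₁ ε³ t⁶/8 ≤ Tm·e + τ v₁ ε³ t⁶/16` (`16 v₁ c_θ κ³ = 1`,
`w₀ = κ t`), `Tm·t ≤ ε (2 + 4√3/κ)` (`τ, t ≤ 1`) and `ρ' ≤ t⁴` to `c₁ ε² τ ρ' t³ ≤ e`. [folklore] -/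
theorem real_core {τ v₁ ε t κ cθ Tm e ρ' : ℝ} (hτ : 0 < τ) (hτ1 : τ ≤ 1) (hv₁ : 0 < v₁) (hε : 0 < ε)
    (ht : 0 < t) (ht1 : t ≤ 1) (hκ : 0 < κ) (hid : 16 * v₁ * cθ * κ ^ 3 = 1)
    (hTm : Tm = 2 * ε * (τ + 2 * Real.sqrt 3 / (κ * t))) (he : 0 ≤ e) (hρ't : ρ' ≤ t ^ 4)
    (H : τ * ((ε / 2) ^ 3 * v₁) * (t ^ 3) ^ 2 ≤
      Tm * e + τ * (ε ^ 3 * v₁ * (cθ * ((κ * t) ^ 3 * v₁))) * t ^ 3) :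
    v₁ / (16 * (2 + 4 * Real.sqrt 3 / κ)) * ε ^ 2 * τ * ρ' * t ^ 3 ≤ e := by
  set A : ℝ := 2 + 4 * Real.sqrt 3 / κ with hA_def
  have hA : 0 < A := by positivity
  -- (3): `Tm · e ≥ τ v₁ ε³ t⁶ / 16`
  have h1 : τ * v₁ * ε ^ 3 * t ^ 6 / 16 ≤ Tm * e := by
    have h16 : v₁ * cθ * κ ^ 3 = 1 / 16 := by linarith
    have hs : τ * (ε ^ 3 * v₁ * (cθ * ((κ * t) ^ 3 * v₁))) * t ^ 3 = τ * v₁ * ε ^ 3 * t ^ 6 / 16 := by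
      calc τ * (ε ^ 3 * v₁ * (cθ * ((κ * t) ^ 3 * v₁))) * t ^ 3
          = τ * v₁ * ε ^ 3 * t ^ 6 * (v₁ * cθ * κ ^ 3) := by ring
        _ = τ * v₁ * ε ^ 3 * t ^ 6 / 16 := by rw [h16]; ring
    have hl : τ * ((ε / 2) ^ 3 * v₁) * (t ^ 3) ^ 2 = τ * v₁ * ε ^ 3 * t ^ 6 / 8 := by ring
    rw [hs, hl] at H
    linarith
  -- `Tm · t ≤ ε A`
  have h2 : Tm * t ≤ ε * A := by
    have hτt : τ * t ≤ 1 := by nlinarith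
    have hexp : Tm * t = 2 * ε * (τ * t) + 4 * Real.sqrt 3 * ε / κ := by
      rw [hTm]; field_simp; ring
    have h2ε : 2 * ε * (τ * t) ≤ 2 * ε * 1 := mul_le_mul_of_nonneg_left hτt (by positivity)
    rw [hexp, hA_def]
    calc 2 * ε * (τ * t) + 4 * Real.sqrt 3 * ε / κ ≤ 2 * ε * 1 + 4 * Real.sqrt 3 * ε / κ := by linarith
      _ = ε * (2 + 4 * Real.sqrt 3 / κ) := by ring
  -- combine and divide
  have h3 : τ * v₁ * ε ^ 3 * t ^ 7 / 16 ≤ ε * A * e := by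
    calc τ * v₁ * ε ^ 3 * t ^ 7 / 16 = τ * v₁ * ε ^ 3 * t ^ 6 / 16 * t := by ring
      _ ≤ Tm * e * t := mul_le_mul_of_nonneg_right h1 ht.le
      _ = Tm * t * e := by ring
      _ ≤ ε * A * e := mul_le_mul_of_nonneg_right h2 he
  have h4 : v₁ / (16 * A) * ε ^ 2 * τ * t ^ 7 ≤ e := by
    have hεA : 0 < ε * A := by positivity
    have : v₁ / (16 * A) * ε ^ 2 * τ * t ^ 7 = τ * v₁ * ε ^ 3 * t ^ 7 / 16 / (ε * A) := by
      field_simp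
    rw [this, div_le_iff₀ hεA]
    calc τ * v₁ * ε ^ 3 * t ^ 7 / 16 ≤ ε * A * e := h3
      _ = e * (ε * A) := by ring
  calc v₁ / (16 * A) * ε ^ 2 * τ * ρ' * t ^ 3 ≤ v₁ / (16 * A) * ε ^ 2 * τ * t ^ 4 * t ^ 3 := by gcongr
    _ = v₁ / (16 * A) * ε ^ 2 * τ * t ^ 7 := by ring
    _ ≤ e := h4

/-- **Steps (1)–(4) at a fixed thickness `ε ∈ (0, 1/2)`**: with `v₁ = vol(B₁)`, `c_θ = (2πθ)^{-3/2}`,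
`16 v₁ c_θ κ³ = 1` and `c₁ = v₁/(16(2 + 4√3/κ))`, every measurable `S` with `μ(S) ≥ ρ` satisfies
`c₁ ε² τ ρ^{4/3} μ(S) ≤ ∫_S μ({Cross z ·} ∩ S) dμ(z)`. [folklore] -/
theorem supersat_at (θ : ℝ) [IsProbabilityMeasure (oneStickLaw θ)] (hθ : 0 < θ) {v₁ κ : ℝ} (hv₁ : 0 < v₁)
    (hball : ∀ r : ℝ, 0 ≤ r → volume (Metric.ball (0 : V3) r) = ENNReal.ofReal (r ^ 3 * v₁)) (hκ : 0 < κ)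
    (hid : 16 * v₁ * (2 * Real.pi * θ) ^ (-(Module.finrank ℝ V3 : ℝ) / 2) * κ ^ 3 = 1)
    (ε τ ρ : ℝ) (hε : 0 < ε) (hε2 : ε < 1 / 2) (hτ : 0 < τ) (hτ1 : τ ≤ 1) (hρ : 0 < ρ)
    (S : Set (T3 × V3)) (hS : MeasurableSet S) (hρS : ENNReal.ofReal ρ ≤ oneStickLaw θ S) :
    ENNReal.ofReal (v₁ / (16 * (2 + 4 * Real.sqrt 3 / κ)) * ε ^ 2 * τ * ρ ^ (4 / 3 : ℝ)) * oneStickLaw θ S ≤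
      ∫⁻ z in S, oneStickLaw θ ({z' | Cross ε τ z z'} ∩ S) ∂(oneStickLaw θ) := by
  set μ := oneStickLaw θ with hμ
  set cθ : ℝ := (2 * Real.pi * θ) ^ (-(Module.finrank ℝ V3 : ℝ) / 2) with hcθ_def
  have hcθ : 0 < cθ := Real.rpow_pos_of_pos (by positivity) _
  have hε1 : ε < 1 := hε2.trans (by norm_num)
  -- the level `s = μ(S) ∈ [ρ, 1]` and `t = s^{1/3}`
  set s : ℝ := (μ S).toReal with hs_def
  have hμS : μ S = ENNReal.ofReal s := (ENNReal.ofReal_toReal (measure_ne_top μ S)).symm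
  have hρs : ρ ≤ s := (ENNReal.ofReal_le_iff_le_toReal (measure_ne_top μ S)).1 hρS
  have hs0 : 0 < s := hρ.trans_le hρs
  have hs1 : s ≤ 1 := ENNReal.toReal_le_of_le_ofReal zero_le_one (ENNReal.ofReal_one.symm ▸ prob_le_one)
  set t : ℝ := s ^ (1 / 3 : ℝ) with ht_def
  have ht : 0 < t := Real.rpow_pos_of_pos hs0 _
  have ht1 : t ≤ 1 := Real.rpow_le_one hs0.le hs1 (by norm_num)
  have ht3 : t ^ 3 = s := by
    rw [ht_def, ← Real.rpow_natCast, ← Real.rpow_mul hs0.le]; norm_num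
  have hs43 : s ^ (4 / 3 : ℝ) = t ^ 4 := by
    rw [ht_def, ← Real.rpow_natCast, ← Real.rpow_mul hs0.le]; norm_num
  have hρ43 : ρ ^ (4 / 3 : ℝ) ≤ t ^ 4 := hs43 ▸ Real.rpow_le_rpow hρ.le hρs (by norm_num)
  have hw₀ : 0 < κ * t := mul_pos hκ ht
  have hTm0 : 0 ≤ 2 * ε * (τ + 2 * Real.sqrt 3 / (κ * t)) := by positivity
  -- the crossing energy `e`; if it is infinite there is nothing to prove
  set e := ∫⁻ z in S, μ ({z' | Cross ε τ z z'} ∩ S) ∂μ with he_def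
  by_cases he : e = ⊤
  · rw [he]; exact le_top
  set e' : ℝ := e.toReal with he'_def
  have hee' : e = ENNReal.ofReal e' := (ENNReal.ofReal_toReal he).symm
  have he'0 : 0 ≤ e' := ENNReal.toReal_nonneg
  -- steps (1) and (2) in `ℝ≥0∞`, then in `ℝ`
  have hmain := (occ_energy_lower θ S hS ε τ hε hε1).trans
    (occ_energy_upper θ hθ S ε τ (κ * t) hε hε2 hτ.le hw₀)
  have hL : ENNReal.ofReal (τ * ((ε / 2) ^ 3 * v₁) * (t ^ 3) ^ 2) =
      ENNReal.ofReal τ * (volume (Metric.ball (0 : V3) (ε / 2)) * μ S ^ 2) := by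
    rw [ENNReal.ofReal_mul (q := (t ^ 3) ^ 2) (by positivity), ENNReal.ofReal_mul (p := τ) hτ.le,
      ENNReal.ofReal_pow (pow_nonneg ht.le 3) 2, hball _ (by positivity), hμS, ht3, mul_assoc]
  have hR : ENNReal.ofReal (2 * ε * (τ + 2 * Real.sqrt 3 / (κ * t)) * e' +
        τ * (ε ^ 3 * v₁ * (cθ * ((κ * t) ^ 3 * v₁))) * t ^ 3) =
      ENNReal.ofReal (2 * ε * (τ + 2 * Real.sqrt 3 / (κ * t))) * e + ENNReal.ofReal τ *
        (volume (Metric.ball (0 : V3) ε) * (ENNReal.ofReal cθ * volume (Metric.ball (0 : V3) (κ * t)))) * μ S := by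
    rw [ENNReal.ofReal_add (by positivity) (by positivity), ENNReal.ofReal_mul (q := e') hTm0, ← hee',
      ENNReal.ofReal_mul (q := t ^ 3) (by positivity), ENNReal.ofReal_mul (p := τ) hτ.le,
      ENNReal.ofReal_mul (p := ε ^ 3 * v₁) (by positivity), ENNReal.ofReal_mul (p := cθ) hcθ.le,
      hball _ hε.le, hball _ hw₀.le, hμS, ht3]
  have hreal : τ * ((ε / 2) ^ 3 * v₁) * (t ^ 3) ^ 2 ≤ 2 * ε * (τ + 2 * Real.sqrt 3 / (κ * t)) * e' +
      τ * (ε ^ 3 * v₁ * (cθ * ((κ * t) ^ 3 * v₁))) * t ^ 3 := by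
    rw [← ENNReal.ofReal_le_ofReal_iff (by positivity), hL, hR]
    exact hmain
  have hcore := real_core hτ hτ1 hv₁ hε ht ht1 hκ hid rfl he'0 hρ43 hreal
  -- the goal
  rw [hμS, hee', ← ENNReal.ofReal_mul (by positivity)]
  refine ENNReal.ofReal_le_ofReal ?_
  calc v₁ / (16 * (2 + 4 * Real.sqrt 3 / κ)) * ε ^ 2 * τ * ρ ^ (4 / 3 : ℝ) * s
      = v₁ / (16 * (2 + 4 * Real.sqrt 3 / κ)) * ε ^ 2 * τ * ρ ^ (4 / 3 : ℝ) * t ^ 3 := by rw [ht3]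
    _ ≤ e' := hcore

end SupersatAssembly

end FewIdle

/-- **REGISTERED STUB `stub_stickSupersat` — the 7/3 crossing-energy law for random sticks.** For `0 < σ < 1/2`
and `θ > 0` there is `c₁ = c₁(θ) > 0` (namely `v₁/(16(2 + 4√3/κ))` with `v₁ = vol(B₁)`, `16 v₁ (2πθ)^{-3/2} κ³ = 1`)
such that for all `N`, `τ, ρ ∈ (0, 1]` and measurable `S` with `μ₁(S) ≥ ρ`,
`∫_S μ₁({Cross ε_N τ z ·} ∩ S) dμ₁(z) ≥ c₁ ε_N² τ ρ^{4/3} μ₁(S)`. Proof: the occupation-time trick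
`P(T > 0) ≥ E[T]/sup T` (fast pairs, `occ_fast_bound`) plus one Cauchy–Schwarz in space at fixed time
(`fixedTime_bound_reg`) minus the slow pairs (`slow_time_integral_bound`), at `ε_N = σ(N+1)^{-1/3} ≤ σ < 1/2`.
[folklore] -/
theorem stub_stickSupersat : ∀ σ θ : ℝ, 0 < σ → σ < 1 / 2 → 0 < θ → FewIdle.StickSupersat σ θ := by
  intro σ θ hσ hσ2 hθ
  haveI hP : IsProbabilityMeasure (FewIdle.oneStickLaw θ) := FewIdle.isProbabilityMeasure_oneStickLaw hθ
  -- constants: `v₁ = vol(B₁)`, `c_θ = (2πθ)^{-3/2}`, `κ = (16 v₁ c_θ)^{-1/3}`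
  set v₁ : ℝ := (volume (Metric.ball (0 : V3) 1)).toReal with hv₁_def
  have hv₁ : 0 < v₁ :=
    ENNReal.toReal_pos (Metric.measure_ball_pos volume (0 : V3) one_pos).ne' measure_ball_lt_top.ne
  have hvol1 : volume (Metric.ball (0 : V3) 1) = ENNReal.ofReal v₁ :=
    (ENNReal.ofReal_toReal measure_ball_lt_top.ne).symm
  have hball : ∀ r : ℝ, 0 ≤ r → volume (Metric.ball (0 : V3) r) = ENNReal.ofReal (r ^ 3 * v₁) := by
    intro r hr
    rw [Measure.addHaar_ball volume (0 : V3) hr, finrank_euclideanSpace_fin, hvol1,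
      ← ENNReal.ofReal_mul (by positivity)]
  set cθ : ℝ := (2 * Real.pi * θ) ^ (-(Module.finrank ℝ V3 : ℝ) / 2) with hcθ_def
  have hcθ : 0 < cθ := Real.rpow_pos_of_pos (by positivity) _
  have h16 : (0 : ℝ) < 16 * v₁ * cθ := by positivity
  set κ : ℝ := (16 * v₁ * cθ) ^ (-(1 / 3 : ℝ)) with hκ_def
  have hκ : 0 < κ := Real.rpow_pos_of_pos h16 _
  have hid : 16 * v₁ * cθ * κ ^ 3 = 1 := by
    rw [hκ_def, ← Real.rpow_natCast, ← Real.rpow_mul h16.le,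
      show -(1 / 3 : ℝ) * ((3 : ℕ) : ℝ) = -1 by norm_num, Real.rpow_neg_one]
    field_simp
  refine ⟨v₁ / (16 * (2 + 4 * Real.sqrt 3 / κ)), by positivity, ?_⟩
  intro N τ ρ hτ hτ1 hρ _ S hS hρS
  exact FewIdle.SupersatAssembly.supersat_at θ hθ hv₁ hball hκ hid (hsDiameter σ N) τ ρ (hsDiameter_pos hσ N)
    ((hsDiameter_le hσ.le N).trans_lt hσ2) hτ hτ1 hρ S hS hρS

end

end Summit.AtomisticToContinuum.HydrodynamicLimit.Theorems.DiffuseBackwardInfluenceShare
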